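import Summits.QuantumFields.YangMills.Theorems.UnitScaleTiltHalvingP1FlatCoreSupplierInduction
import Literature.MathematicalPhysics.QuantumFieldTheory.Balaban1983to89.B8Prop3GaugeFixedKLevel
import Literature.MathematicalPhysics.QuantumFieldTheory.Balaban1983to89.B8Eq131CubesAdmissible
import HarnessLib

/-!
# `hP1room` PROGRAMME — EDITION γ (OWNER RULING g28-№11, LEAD-H WORDS 21∕22), FILE (γ-3b): THREE SMALL ROWS THE γ COMPOSERS READ OFF THE DATUM
# (`W` unitary and in `𝔄_m(α₀)` on any family, by gauge invariance of (1.34); (1.66)₀ on the sides touching `□₀` off J3's tower row (d) at depth `k`;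
# the scalar β rows at `aβ := s`)

Route `UnitScaleTilt`, crux K1 child «MinimiserStabilityRegPr» (stmt-QuantumFields-19200), registered stub `stub_halvingStep` (`BirthV10`).  Cell `ym3-torus` (HUMAN RULING
D-0037: YM₃ on T³ is ladder rung R3 — NOT d = 4, NOT infinite volume, NOT a mass gap, NOT the Clay problem), width seat `ym-ust-19200-w3` gen 9.  `--supports
stmt-QuantumFields-19200 --as helper`; THEOREMS ONLY (0 `def`, 0 `sorry`); count-neutral; nothing here claims any socket, the stub, the crux or the gap.

WHAT (bookkeeping the (γ-3) composers `siteRows_of_socketsTγ` (k ≥ 2) ∕ ★w7's k = 1 twin would otherwise inline).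
* `datumRowsγ` — for a datum `W` with `W^{u₁} = U′` (`u₁`, `U′` unitary) and `U′ ∈ 𝔄_k(α₀)` on `ℤᵈ` (J3's (1.34)-𝔄 row): `W` is unitary (lit ✓`mem_unitaryUnits_of_mgauge_eq`) and
  `W ∈ 𝔄_m(α₀)` on every family `Ω`, `m ≤ k` (✓`h34_of_inAk_univ`, lit ✓`mulCfg_eq_gaugeAct_of_mgauge_eq`, ✓`B8Ineq132.inAk_gaugeAct_iff`, ✓`mulCfg_one_right`) — the two
  antecedents of the displayed flat (1.59) socket `H59Dγ` the composer reads at its datum.  [Balaban1985RegularSpaces] (1.34) p.82 (gauge invariance of `𝔄_k`).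
* `h66_of_towerRow` — J3's tower row (d) `‖(U′)̄^{(k−m′)} − 1‖ < s` on the tower boxes, read at depth `m′ := k` (`(U′)̄^{(0)} = U′`, ✓`avgIter_zero`) on the sides touching
  `□₀ = cube … k 0` (inside the depth-`k` box by lit ✓`collar_cube` + ✓`ends_of_sideTouches`): (1.66)₀ `‖U′(b) − 1‖ ≤ s` there.  [Balaban1985RegularSpaces] (1.66) p.87.
* `betaScalarRows` — the three scalar β rows of T4γ at `aβ := s`: `s ≤ ¼`, `s ≤ dLα₁`, `4·B_∂·s ≤ (dL − 1)·B₀·(ε₀ + α₁)` from `s ≤ ⅙`, `s ≤ α₁`, `4·B_∂ ≤ (dL − 1)·B₀`.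
HONEST SCOPE: three one-step lemmas; nothing of Prop. 3∕5, Theorem 4 or the stub is proved here.

References: T. Bałaban, CMP **99** (1985) 75–102 [Balaban1985RegularSpaces] ((1.34) p.82, (1.66) p.87, (1.131) p.99).
-/

set_option autoImplicit false

noncomputable section

namespace Summit.QuantumFields.YangMills.Theorems.HalvingHSiteDatumRowsGamma

open Literature.MathematicalPhysics.QuantumFieldTheory.Balaban1983to89
open B7Prop1Explicit (Site e U1)
open B7Prop2Explicit (unitaryUnits avgIter unitaryUnits_le_U1)
open B7Eq92Concrete (mgauge)
open B8Ineq130 (tlo thi)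
open B8Ineq132 (InAk)
open B8Eq131Cubes (tLo tHi collar_cube)
open B8Eq131CubesAdmissible (cubeFam cubeFam_false_of_le)
open B8Eq140Level (SideTouches)
open B8Lemma1NonAbelian (mulCfg)
open B8Prop3GaugeFixedKLevel (mem_unitaryUnits_of_mgauge_eq mulCfg_eq_gaugeAct_of_mgauge_eq)
open HalvingP1FlatCoreSupplierInduction (h34_of_inAk_univ ends_of_sideTouches mulCfg_one_right)

variable {d : ℕ} {𝔸 : Type*} [CStarAlgebra 𝔸] [Nontrivial 𝔸]

/-- **`W` unitary and `W ∈ 𝔄_m(α₀)` on any family**, for a datum `W` with `W^{u₁} = U′`, `u₁`, `U′` unitary, `U′ ∈ 𝔄_k(α₀)` on `ℤᵈ`, `m ≤ k` (gauge invariance of (1.34)).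
[cite: Balaban1985RegularSpaces, (1.34) p.82] -/
theorem datumRowsγ {L k m : ℕ} (hmk : m ≤ k) {η α₀ : ℝ} {U' : Site d → Fin d → 𝔸ˣ} (hU' : ∀ x κ, U' x κ ∈ unitaryUnits 𝔸)
    {u₁ : Site d → 𝔸ˣ} (hu₁ : ∀ x, u₁ x ∈ unitaryUnits 𝔸) {W : Site d → Fin d → 𝔸ˣ} (hW : mgauge (1 : Site d → Fin d → 𝔸ˣ) u₁ W = U')
    (hInAk : InAk L k η α₀ (fun _ => (Set.univ : Set (Site d))) U') (Ω : ℕ → Set (Site d)) :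
    (∀ x κ, W x κ ∈ unitaryUnits 𝔸) ∧ InAk L m η α₀ Ω W := by
  have h1u : ∀ (x : Site d) (κ : Fin d), (1 : Site d → Fin d → 𝔸ˣ) x κ ∈ unitaryUnits 𝔸 := fun _ _ => (unitaryUnits 𝔸).one_mem
  refine ⟨mem_unitaryUnits_of_mgauge_eq h1u hU' hu₁ hW, ?_⟩
  have h34 := h34_of_inAk_univ hInAk Ω
  have hui : ∀ x, u₁⁻¹ x ∈ U1 𝔸 := fun x => unitaryUnits_le_U1 ((unitaryUnits 𝔸).inv_mem (hu₁ x))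
  have h1 : InAk L m η α₀ Ω (mulCfg W (1 : Site d → Fin d → 𝔸ˣ)) := by
    rw [mulCfg_eq_gaugeAct_of_mgauge_eq hW]
    exact (B8Ineq132.inAk_gaugeAct_iff L m η α₀ _ hui _).2 fun j hj => h34 j (hj.trans hmk)
  rwa [mulCfg_one_right] at h1

omit [Nontrivial 𝔸] in
/-- **(1.66)₀ on the sides touching `□₀` off J3's tower row (d) at depth `k`** (`L ≥ 2`, `ρ ≥ 1`). [cite: Balaban1985RegularSpaces, (1.66) p.87, (1.131) p.99] -/
theorem h66_of_towerRow {L : ℕ} (hL : 2 ≤ L) {a : Site d} {M ρ : ℕ} (hρ : 1 ≤ ρ) {k : ℕ} {U' : Site d → Fin d → 𝔸ˣ} {s : ℝ}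
    (htw : ∀ m', m' ≤ k → ∀ (x : Site d) (ν : Fin d), tlo L (tLo a ρ) m' ≤ x → x + e ν ≤ thi L (tHi a M ρ) m' →
      ‖((avgIter L U' (k - m') x ν : 𝔸ˣ) : 𝔸) - 1‖ < s) :
    ∀ b ∈ {b : Site d × Fin d | SideTouches (cubeFam false L a M ρ k 0) b.1 b.2}, ‖((U' b.1 b.2 : 𝔸ˣ) : 𝔸) - 1‖ ≤ s := by
  intro b hb
  have hb' : SideTouches (cubeFam false L a M ρ k 0) b.1 b.2 := hb
  rw [cubeFam_false_of_le L a M ρ (Nat.zero_le k)] at hb'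
  obtain ⟨h1, h2⟩ := ends_of_sideTouches (collar_cube hL hρ (Nat.zero_le k)) hb'
  have h := htw k le_rfl b.1 b.2 h1 h2
  rw [Nat.sub_self, B7Prop2Explicit.avgIter_zero] at h
  exact h.le

/-- **The three scalar β rows of T4γ at `aβ := s`.** [cite: Balaban1985RegularSpaces, (1.66) p.87, (1.57)-(1.59) p.86] -/
theorem betaScalarRows {dr Lr s α₁ ε₀ B₀ Bbd : ℝ} (hd : 1 ≤ dr) (hL : 1 ≤ Lr) (hs0 : 0 ≤ s) (hs6 : s ≤ 1 / 6) (hsα₁ : s ≤ α₁) (hα₁ : 0 < α₁)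
    (hε₀ : 0 < ε₀) (hB₀ : 0 < B₀) (hBd : 4 * Bbd ≤ (dr * Lr - 1) * B₀) :
    s ≤ 1 / 4 ∧ s ≤ dr * Lr * α₁ ∧ 4 * Bbd * s ≤ (dr * Lr - 1) * B₀ * (ε₀ + α₁) := by
  have hdL1 : (1 : ℝ) ≤ dr * Lr := by nlinarith
  refine ⟨hs6.trans (by norm_num), hsα₁.trans (le_mul_of_one_le_left hα₁.le hdL1), ?_⟩
  have h1 : s ≤ ε₀ + α₁ := hsα₁.trans (by linarith)
  have h2 : 0 ≤ (dr * Lr - 1) * B₀ := mul_nonneg (by linarith) hB₀.le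
  calc 4 * Bbd * s ≤ (dr * Lr - 1) * B₀ * s := mul_le_mul_of_nonneg_right hBd hs0
    _ ≤ (dr * Lr - 1) * B₀ * (ε₀ + α₁) := mul_le_mul_of_nonneg_left h1 h2

end Summit.QuantumFields.YangMills.Theorems.HalvingHSiteDatumRowsGamma

end
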